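import Mathlib
import Literature.Topology.Euclidean.BrouwerFixedPoint

/-!
# Gluing a zero-free homotopy into a global `C¹` field (Kronecker existence theorem, step K4)

Crux `WitnessCharge` (stmt-SmoothPoincare4-7824), route `SullivanDual`, line Sketch. The F5
programme (McDuff's cusp theorem via the twisted difference map of a `J`-holomorphic curve) uses a
Kronecker existence theorem on sup-norm cubes of `ℝⁿ⁺¹` (`Fin (n + 1) → ℝ`, `‖x‖ = max |xᵢ|`, so
`closedBall 0 ρ` is a cube). This file provides its gluing step: given a field `F`, continuous on
the big cube `closedBall 0 ρ` and zero-free on the small cube `closedBall 0 ρ₀`, and a jointly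
continuous zero-free homotopy `H` on the collar `ρ₀ ≤ ‖x‖ ≤ ρ` from `F` to a `C¹` model `P`, there
is a *global* `C¹` field `Φ` which agrees with `P` outside a cube of some radius `ρ₁ ∈ (ρ₀, ρ)`
and is zero-free on the big closed cube.

Construction: (1) unroll the homotopy radially, `Ψ x = F x` for `‖x‖ ≤ ρ₀` and
`Ψ x = H (σ ‖x‖) x` on the collar with `σ` the affine clamp sending `ρ₀ ↦ 0`, `ρ ↦ 1`, extended
to the whole space through the radial retraction onto the big cube (`continuous_if`); `Ψ` is
continuous, zero-free on the big cube (so `‖Ψ‖ ≥ m > 0` there by compactness) and, by uniform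
continuity of `H` on its compact domain, `‖Ψ - P‖ < m / 4` on an outer collar `ρ₂ ≤ ‖x‖ ≤ ρ`;
(2) mollify `Ψ` to a smooth `G` within `m / 4` on the big cube
(`Literature.Topology.Euclidean.Brouwer.exists_contDiff_approx`); (3) glue with a smooth cutoff
`b` (`ContDiffBump`, `= 1` on `closedBall 0 ρ₂`, `= 0` outside `ball 0 ρ₁`):
`Φ = b • G + (1 - b) • P`.

Mathlib and `Literature/Topology/Euclidean/BrouwerFixedPoint.lean` only; no definitions,
no `sorry`.
-/

noncomputable section

-- the summit path `SmoothPoincare4/SmoothPoincare4` forces a duplicated namespace segment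
set_option linter.dupNamespace false

open Set Filter Metric Function
open scoped Topology ContDiff

namespace Summit.SmoothPoincare4.SmoothPoincare4.Theorems.WitnessCharge.PencilIncompleteness

variable {E : Type*} [NormedAddCommGroup E] [NormedSpace ℝ E]

/-- The radial retraction `x ↦ (ρ / max ρ ‖x‖) • x` onto the closed ball of radius `ρ > 0`: it is
continuous, has norm `min ρ ‖x‖`, and is the identity on the closed ball. -/
private theorem exists_retraction {ρ : ℝ} (hρ : 0 < ρ) :
    ∃ r : E → E, Continuous r ∧ (∀ x, ‖r x‖ = min ρ ‖x‖) ∧ ∀ x, ‖x‖ ≤ ρ → r x = x := by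
  have hpos : ∀ x : E, 0 < max ρ ‖x‖ := fun x => hρ.trans_le (le_max_left _ _)
  refine ⟨fun x => (ρ / max ρ ‖x‖) • x, ?_, ?_, ?_⟩
  · exact (continuous_const.div (continuous_const.max continuous_norm)
      fun x => (hpos x).ne').smul continuous_id
  · intro x
    rw [norm_smul, Real.norm_of_nonneg (div_nonneg hρ.le (hpos x).le)]
    rcases le_total ‖x‖ ρ with h | h
    · rw [max_eq_left h, min_eq_right h, div_self hρ.ne', one_mul]
    · rw [max_eq_right h, min_eq_left h, div_mul_cancel₀ _ (hρ.trans_le h).ne']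
  · intro x hx
    simp only [max_eq_left hx, div_self hρ.ne', one_smul]

/-- **Radial unrolling of the homotopy.** For `F` continuous on `closedBall 0 ρ` and `H` jointly
continuous on `Icc 0 1 ×ˢ (closedBall 0 ρ \ ball 0 ρ₀)` with `H 0 = F` on the collar, the field
which is `F` on the small cube and `H (σ ‖x‖) x` on the collar, `σ t = min 1 ((t - ρ₀) / (ρ - ρ₀))`,
extends to a continuous field on the whole space. -/
private theorem exists_unrolled {ρ₀ ρ : ℝ} {F : E → E} {H : ℝ → E → E} (hρ₀ : 0 < ρ₀)
    (hρ₀ρ : ρ₀ < ρ) (hF : ContinuousOn F (closedBall 0 ρ))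
    (hH : ContinuousOn (uncurry H) (Icc (0 : ℝ) 1 ×ˢ (closedBall 0 ρ \ ball 0 ρ₀)))
    (hH0 : ∀ x, ρ₀ ≤ ‖x‖ → ‖x‖ ≤ ρ → H 0 x = F x) :
    ∃ Ψ : E → E, Continuous Ψ ∧ (∀ x, ‖x‖ ≤ ρ₀ → Ψ x = F x) ∧
      ∀ x, ρ₀ < ‖x‖ → ‖x‖ ≤ ρ → Ψ x = H (min 1 ((‖x‖ - ρ₀) / (ρ - ρ₀))) x := by
  obtain ⟨r, hr, hrn, hrid⟩ := exists_retraction (E := E) (hρ₀.trans hρ₀ρ)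
  have hρρ₀ : 0 < ρ - ρ₀ := sub_pos.mpr hρ₀ρ
  -- the clamped affine reparametrisation
  set σ : E → ℝ := fun x => min 1 ((‖x‖ - ρ₀) / (ρ - ρ₀)) with hσ
  have hσc : Continuous σ :=
    continuous_const.min ((continuous_norm.sub continuous_const).div_const _)
  refine ⟨fun x => if ‖x‖ ≤ ρ₀ then F x else H (σ x) (r x), ?_, ?_, ?_⟩
  · have hset : {x : E | ‖x‖ ≤ ρ₀} = closedBall (0 : E) ρ₀ := by
      ext x
      simp
    refine continuous_if ?_ ?_ ?_
    · -- the two branches agree on the frontier `‖a‖ = ρ₀`, because `H 0 = F` there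
      rw [hset, frontier_closedBall _ hρ₀.ne']
      intro a ha
      rw [mem_sphere_zero_iff_norm] at ha
      have haρ : ‖a‖ ≤ ρ := by
        rw [ha]
        exact hρ₀ρ.le
      have h0 : σ a = 0 := by
        simp [hσ, ha]
      rw [h0, hrid a haρ]
      exact (hH0 a ha.ge haρ).symm
    · -- the `F`-branch
      rw [hset, closure_closedBall]
      exact hF.mono (closedBall_subset_closedBall hρ₀ρ.le)
    · -- the `H`-branch: composition of `uncurry H` with `x ↦ (σ x, r x)` on `ρ₀ ≤ ‖x‖`
      have hsub : closure {x : E | ¬‖x‖ ≤ ρ₀} ⊆ {x | ρ₀ ≤ ‖x‖} :=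
        closure_minimal (fun x hx => (not_le.mp hx).le)
          (isClosed_le continuous_const continuous_norm)
      refine ContinuousOn.mono ?_ hsub
      show ContinuousOn (uncurry H ∘ fun x => (σ x, r x)) {x | ρ₀ ≤ ‖x‖}
      refine hH.comp (hσc.prodMk hr).continuousOn ?_
      intro x hx
      have hx' : ρ₀ ≤ ‖x‖ := hx
      refine ⟨⟨le_min zero_le_one (div_nonneg (sub_nonneg.mpr hx') hρρ₀.le), min_le_left _ _⟩,
        ?_, ?_⟩
      · rw [mem_closedBall_zero_iff, hrn]
        exact min_le_left _ _
      · rw [mem_ball_zero_iff, hrn, not_lt]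
        exact le_min hρ₀ρ.le hx'
  · intro x hx
    simp only [if_pos hx]
  · intro x hx hxρ
    simp only [if_neg (not_le.mpr hx), hrid x hxρ, hσ]

/-- **Lower bound and boundary estimate for the unrolled field.** With `Ψ` as in
`exists_unrolled`, if `F` is zero-free on the small cube and `H` is zero-free on the collar with
`H 1 = P` there, then `‖Ψ‖ ≥ m > 0` on the big cube (compactness), and `‖Ψ - P‖ < m / 4` on an
outer collar `ρ₂ ≤ ‖x‖ ≤ ρ`, `ρ₀ < ρ₂ < ρ` (uniform continuity of `H` on its compact domain). -/
private theorem exists_bounds [FiniteDimensional ℝ E] {ρ₀ ρ : ℝ} {F P : E → E} {H : ℝ → E → E}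
    {Ψ : E → E} (hρ₀ρ : ρ₀ < ρ)
    (hH : ContinuousOn (uncurry H) (Icc (0 : ℝ) 1 ×ˢ (closedBall 0 ρ \ ball 0 ρ₀)))
    (hH1 : ∀ x, ρ₀ ≤ ‖x‖ → ‖x‖ ≤ ρ → H 1 x = P x)
    (hHne : ∀ s ∈ Icc (0 : ℝ) 1, ∀ x : E, ρ₀ ≤ ‖x‖ → ‖x‖ ≤ ρ → H s x ≠ 0)
    (hFne : ∀ x ∈ closedBall (0 : E) ρ₀, F x ≠ 0) (hΨ : Continuous Ψ)
    (hΨF : ∀ x, ‖x‖ ≤ ρ₀ → Ψ x = F x)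
    (hΨH : ∀ x, ρ₀ < ‖x‖ → ‖x‖ ≤ ρ → Ψ x = H (min 1 ((‖x‖ - ρ₀) / (ρ - ρ₀))) x) :
    ∃ m ρ₂ : ℝ, 0 < m ∧ ρ₀ < ρ₂ ∧ ρ₂ < ρ ∧ (∀ x ∈ closedBall (0 : E) ρ, m ≤ ‖Ψ x‖) ∧
      ∀ x, ρ₂ ≤ ‖x‖ → ‖x‖ ≤ ρ → ‖Ψ x - P x‖ < m / 4 := by
  have hρρ₀ : 0 < ρ - ρ₀ := sub_pos.mpr hρ₀ρ
  -- the reparametrisation takes values in `Icc 0 1` on the collar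
  have hσI : ∀ x : E, ρ₀ ≤ ‖x‖ → min 1 ((‖x‖ - ρ₀) / (ρ - ρ₀)) ∈ Icc (0 : ℝ) 1 := fun x hx =>
    ⟨le_min zero_le_one (div_nonneg (sub_nonneg.mpr hx) hρρ₀.le), min_le_left _ _⟩
  -- `Ψ` is zero-free on the big cube
  have hΨne : ∀ x ∈ closedBall (0 : E) ρ, 0 < ‖Ψ x‖ := by
    intro x hx
    rw [mem_closedBall_zero_iff] at hx
    rcases le_or_gt ‖x‖ ρ₀ with h | h
    · rw [hΨF x h]
      exact norm_pos_iff.mpr (hFne x (mem_closedBall_zero_iff.mpr h))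
    · rw [hΨH x h hx]
      exact norm_pos_iff.mpr (hHne _ (hσI x h.le) x h.le hx)
  -- a positive lower bound `m` on the compact big cube
  obtain ⟨m, hm, hmΨ⟩ :=
    (isCompact_closedBall (0 : E) ρ).exists_forall_le' hΨ.norm.continuousOn hΨne
  -- uniform continuity of `H` on its compact domain
  have hK : IsCompact (Icc (0 : ℝ) 1 ×ˢ (closedBall (0 : E) ρ \ ball 0 ρ₀)) :=
    isCompact_Icc.prod ((isCompact_closedBall 0 ρ).diff isOpen_ball)
  obtain ⟨δ, hδ, hδH⟩ := Metric.uniformContinuousOn_iff.mp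
    (hK.uniformContinuousOn_of_continuous hH) (m / 4) (by positivity)
  set δ' : ℝ := min δ 1 with hδ'
  have hδ'pos : 0 < δ' := lt_min hδ one_pos
  have hδ'δ : δ' * (ρ - ρ₀) ≤ δ * (ρ - ρ₀) := mul_le_mul_of_nonneg_right (min_le_left _ _) hρρ₀.le
  have hδ'1 : δ' * (ρ - ρ₀) ≤ 1 * (ρ - ρ₀) := mul_le_mul_of_nonneg_right (min_le_right _ _) hρρ₀.le
  have hδ'0 : 0 < δ' * (ρ - ρ₀) := mul_pos hδ'pos hρρ₀
  refine ⟨m, ρ - δ' * (ρ - ρ₀) / 2, hm, by linarith, by linarith, hmΨ, ?_⟩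
  intro x hx hxρ
  have hx₀ : ρ₀ < ‖x‖ := by linarith
  have hxC : x ∈ closedBall (0 : E) ρ \ ball 0 ρ₀ :=
    ⟨mem_closedBall_zero_iff.mpr hxρ, fun h => (not_lt.mpr hx₀.le) (mem_ball_zero_iff.mp h)⟩
  have hsI : min 1 ((‖x‖ - ρ₀) / (ρ - ρ₀)) ∈ Icc (0 : ℝ) 1 := hσI x hx₀.le
  -- the homotopy parameter of `x` is `δ`-close to `1`
  have hs1 : dist (min 1 ((‖x‖ - ρ₀) / (ρ - ρ₀))) 1 < δ := by
    have h1 : 1 - δ < (‖x‖ - ρ₀) / (ρ - ρ₀) := by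
      rw [lt_div_iff₀ hρρ₀]
      nlinarith
    have hs_ge : 1 - δ < min 1 ((‖x‖ - ρ₀) / (ρ - ρ₀)) := lt_min (by linarith) h1
    have hs_le : min 1 ((‖x‖ - ρ₀) / (ρ - ρ₀)) ≤ 1 := min_le_left _ _
    rw [Real.dist_eq, abs_sub_comm, abs_of_nonneg (by linarith)]
    linarith
  have key : dist (H (min 1 ((‖x‖ - ρ₀) / (ρ - ρ₀))) x) (H 1 x) < m / 4 :=
    hδH (min 1 ((‖x‖ - ρ₀) / (ρ - ρ₀)), x) ⟨hsI, hxC⟩ (1, x) ⟨⟨zero_le_one, le_rfl⟩, hxC⟩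
      (by rwa [dist_prod_same_right])
  rw [hΨH x hx₀ hxρ, ← hH1 x hx₀.le hxρ, ← dist_eq_norm]
  exact key

/-- **Mollify and cut off.** If `Ψ` is continuous with `‖Ψ‖ ≥ m > 0` on `closedBall 0 ρ` and
`‖Ψ - P‖ < m / 4` on the outer collar `ρ₂ ≤ ‖x‖ ≤ ρ` for a `C¹` field `P`, then a smooth
`m / 4`-approximation `G` of `Ψ` on the big cube (`exists_contDiff_approx`) glued to `P` by a smooth
cutoff `b` (`= 1` on `closedBall 0 ρ₂`, `= 0` outside `ball 0 ρ₁`, `ρ₁ = (ρ₂ + ρ) / 2`),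
`Φ = b • G + (1 - b) • P`, is `C¹`, equals `P` for `‖x‖ ≥ ρ₁`, and is zero-free on the big cube:
`‖Φ x‖ ≥ 3m/4` where `b x = 1`, and `‖Φ x‖ ≥ ‖P x‖ - ‖G x - P x‖ > 3m/4 - m/2` on the collar. -/
private theorem exists_cutoff_glue [FiniteDimensional ℝ E] {ρ₀ ρ₂ ρ m : ℝ} {P Ψ : E → E}
    (hρ₀ : 0 < ρ₀) (hρ₀₂ : ρ₀ < ρ₂) (hρ₂ρ : ρ₂ < ρ) (hm : 0 < m) (hP : ContDiff ℝ 1 P)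
    (hΨ : Continuous Ψ) (hmΨ : ∀ x ∈ closedBall (0 : E) ρ, m ≤ ‖Ψ x‖)
    (hΨP : ∀ x, ρ₂ ≤ ‖x‖ → ‖x‖ ≤ ρ → ‖Ψ x - P x‖ < m / 4) :
    ∃ (Φ : E → E) (ρ₁ : ℝ), ρ₀ < ρ₁ ∧ ρ₁ < ρ ∧ ContDiff ℝ 1 Φ ∧
      (∀ x, ρ₁ ≤ ‖x‖ → Φ x = P x) ∧ ∀ x ∈ closedBall (0 : E) ρ, Φ x ≠ 0 := by
  -- smooth approximation of `Ψ` on the big cube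
  obtain ⟨G, hG, hGΨ⟩ := Literature.Topology.Euclidean.Brouwer.exists_contDiff_approx hΨ
    (isCompact_closedBall (0 : E) ρ) (by positivity : (0 : ℝ) < m / 4)
  -- smooth cutoff: `1` on `closedBall 0 ρ₂`, `0` outside `ball 0 ((ρ₂ + ρ) / 2)`
  let b : ContDiffBump (0 : E) := ⟨ρ₂, (ρ₂ + ρ) / 2, hρ₀.trans hρ₀₂, by linarith⟩
  refine ⟨fun x => b x • G x + (1 - b x) • P x, (ρ₂ + ρ) / 2, by linarith, by linarith, ?_, ?_,
    ?_⟩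
  · exact (b.contDiff.smul (hG.of_le (mod_cast le_top))).add
      ((contDiff_const.sub b.contDiff).smul hP)
  · intro x hx
    have hb : b x = 0 := b.zero_of_le_dist (by rwa [dist_zero_right])
    simp [hb]
  · intro x hx hΦ
    change b x • G x + (1 - b x) • P x = 0 at hΦ
    have hxρ : ‖x‖ ≤ ρ := mem_closedBall_zero_iff.mp hx
    have h1 : ‖G x - Ψ x‖ ≤ m / 4 := hGΨ x hx
    have h3 : m ≤ ‖Ψ x‖ := hmΨ x hx
    rcases le_or_gt ‖x‖ ρ₂ with h | h
    · -- inner part: `b x = 1`, `Φ x = G x`, `‖G x‖ ≥ 3m/4`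
      have hb : b x = 1 := b.one_of_mem_closedBall (mem_closedBall_zero_iff.mpr h)
      have hGx : G x = 0 := by simpa [hb] using hΦ
      rw [hGx, zero_sub, norm_neg] at h1
      linarith
    · -- outer collar: `‖Φ x‖ ≥ ‖P x‖ - ‖G x - P x‖ > 3m/4 - m/2`
      have h2 : ‖Ψ x - P x‖ < m / 4 := hΨP x h.le hxρ
      have hGP : ‖G x - P x‖ < m / 2 := by
        calc ‖G x - P x‖ = ‖(G x - Ψ x) + (Ψ x - P x)‖ := by rw [sub_add_sub_cancel]
          _ ≤ ‖G x - Ψ x‖ + ‖Ψ x - P x‖ := norm_add_le _ _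
          _ < m / 2 := by linarith
      have hPx : 3 * m / 4 < ‖P x‖ := by
        have := norm_sub_norm_le (Ψ x) (P x)
        linarith
      have hPle : ‖P x‖ ≤ ‖b x • G x + (1 - b x) • P x‖ + ‖G x - P x‖ := by
        calc ‖P x‖ = ‖(b x • G x + (1 - b x) • P x) - b x • (G x - P x)‖ := by
              congr 1
              simp only [smul_sub, sub_smul, one_smul]
              abel
          _ ≤ ‖b x • G x + (1 - b x) • P x‖ + ‖b x • (G x - P x)‖ := norm_sub_le _ _
          _ ≤ ‖b x • G x + (1 - b x) • P x‖ + ‖G x - P x‖ := by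
              rw [norm_smul, Real.norm_of_nonneg b.nonneg]
              have hb1 : b x * ‖G x - P x‖ ≤ ‖G x - P x‖ :=
                mul_le_of_le_one_left (norm_nonneg (G x - P x)) b.le_one
              linarith
      rw [hΦ, norm_zero, zero_add] at hPle
      linarith

/-- **K4 — gluing a zero-free homotopy into a global `C¹` field.** On the sup-norm cube
`E = Fin (n + 1) → ℝ`: let `F` be continuous on `closedBall 0 ρ` and zero-free on
`closedBall 0 ρ₀` (`0 < ρ₀ < ρ`), `P` a `C¹` field, and `H` a jointly continuous homotopy on the
collar `ρ₀ ≤ ‖x‖ ≤ ρ`, zero-free, with `H 0 = F` and `H 1 = P` there. Then there are a `C¹` field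
`Φ` and a radius `ρ₁ ∈ (ρ₀, ρ)` with `Φ = P` for `‖x‖ ≥ ρ₁` and `Φ` zero-free on `closedBall 0 ρ`
(radial unrolling of the homotopy, mollification, smooth cutoff). -/
theorem helper_kronecker_glue :
    ∀ (n : ℕ) (ρ₀ ρ : ℝ) (F P : (Fin (n + 1) → ℝ) → (Fin (n + 1) → ℝ))
      (H : ℝ → (Fin (n + 1) → ℝ) → (Fin (n + 1) → ℝ)),
      0 < ρ₀ → ρ₀ < ρ →
      ContinuousOn F (Metric.closedBall 0 ρ) → ContDiff ℝ 1 P →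
      ContinuousOn (Function.uncurry H)
        (Set.Icc (0 : ℝ) 1 ×ˢ (Metric.closedBall 0 ρ \ Metric.ball 0 ρ₀)) →
      (∀ x : Fin (n + 1) → ℝ, ρ₀ ≤ ‖x‖ → ‖x‖ ≤ ρ → H 0 x = F x ∧ H 1 x = P x) →
      (∀ s ∈ Set.Icc (0 : ℝ) 1, ∀ x : Fin (n + 1) → ℝ, ρ₀ ≤ ‖x‖ → ‖x‖ ≤ ρ → H s x ≠ 0) →
      (∀ x ∈ Metric.closedBall (0 : Fin (n + 1) → ℝ) ρ₀, F x ≠ 0) →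
      ∃ (Φ : (Fin (n + 1) → ℝ) → (Fin (n + 1) → ℝ)) (ρ₁ : ℝ), ρ₀ < ρ₁ ∧ ρ₁ < ρ ∧
        ContDiff ℝ 1 Φ ∧ (∀ x : Fin (n + 1) → ℝ, ρ₁ ≤ ‖x‖ → Φ x = P x) ∧
        (∀ x ∈ Metric.closedBall (0 : Fin (n + 1) → ℝ) ρ, Φ x ≠ 0) := by
  intro n ρ₀ ρ F P H hρ₀ hρ₀ρ hF hP hH hH01 hHne hFne
  obtain ⟨Ψ, hΨ, hΨF, hΨH⟩ := exists_unrolled hρ₀ hρ₀ρ hF hH fun x h h' => (hH01 x h h').1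
  obtain ⟨m, ρ₂, hm, hρ₀₂, hρ₂ρ, hmΨ, hΨP⟩ :=
    exists_bounds hρ₀ρ hH (fun x h h' => (hH01 x h h').2) hHne hFne hΨ hΨF hΨH
  exact exists_cutoff_glue hρ₀ hρ₀₂ hρ₂ρ hm hP hΨ hmΨ hΨP

end Summit.SmoothPoincare4.SmoothPoincare4.Theorems.WitnessCharge.PencilIncompleteness
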